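import Summits.ResolutionOfSingularities.ResolutionOfSingularities.Theorems.FrobeniusLadderFRationalResolutionDivisorialIdealsCharacteristic
import Mathlib.LinearAlgebra.Span.Basic
import Mathlib.Algebra.Ring.NonZeroDivisors
import HarnessLib

/-!
# Crux `FrobeniusLadder.FRationalResolution` (stmt-ResolutionOfSingularities-15317), line `redirect`,
# stub `stub_diagonalizableQuotientResolution` — TRACE-IDEAL BASICS for computing the finite set `𝒯` of the intrinsic centre `𝔞_tot`
# (first lemmas toward item (α′) of MEMO-15317-leafhand2-g17 §3: `𝒯 = {τ(I) : I nonzero divisorial}`, inline `τ(I) = ⨆_{φ : I →ₗ A} range φ`)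

The class-group centre of `…DivisorialIdealsCharacteristic` (p839146) / `…IntrinsicRecipe` (capstone) is `∏_{T ∈ 𝒯} T` with `𝒯` the set of trace
ideals of the nonzero divisorial ideals; to compute `𝒯` for a concrete germ one needs the dictionary proved here (def-free, any commutative ring):

* `le_traceIdeal` — `I ⊆ τ(I)` (the inclusion is a functional); `traceIdeal_top` — `τ(A) = A`;
* `traceIdeal_eq_of_linearEquiv` — `τ` is an invariant of the ISOMORPHISM CLASS of `I` as an `A`-module (so `𝒯` is indexed by the divisor class
  group: divisorial ideals in the same class have the same trace ideal);
* ★ `traceIdeal_eq_top_of_mem_nonZeroDivisors` — **`τ((a)) = A` for a non-zero-divisor `a`** (`(a) ≅ A`): principal classes contribute the harmless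
  factor `⊤` to `𝔞_tot`;
* `divisorial_span_singleton` — a principal ideal `(a) ≠ 0` IS a nonzero divisorial (v-) ideal in the sense of p839146, so `⊤ ∈ 𝒯` as soon as `A`
  has a non-zero-divisor non-unit… or unit: `top_mem` (for `A` nontrivial).

Honest label: general commutative algebra toward ONE leaf stub (no stub, crux or summit closed). No definitions, no named facts, no sorry.
[folklore; cite: Matsumura1987, §11] [cite: StacksProject, Tag 0AUU]
-/

-- single-problem summit: the doubled namespace component is forced
set_option linter.dupNamespace false

namespace Summit.ResolutionOfSingularities.ResolutionOfSingularities.Theorems.FRationalResolution.TraceIdealBasics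

universe u

/-! ## §1 Elementary properties of `τ(I) = Σ_φ φ(I)` -/

/-- `I ⊆ τ(I)`: the inclusion `I ↪ A` is one of the functionals. [folklore] -/
theorem le_traceIdeal {A : Type u} [CommRing A] (I : Ideal A) :
    I ≤ (⨆ φ : I →ₗ[A] A, LinearMap.range φ : Ideal A) := by
  refine le_trans (le_of_eq ?_) (le_iSup (fun φ : I →ₗ[A] A => LinearMap.range φ) I.subtype)
  exact (Submodule.range_subtype I).symm

/-- `τ(A) = A`. [folklore] -/
theorem traceIdeal_top {A : Type u} [CommRing A] :
    (⨆ φ : (⊤ : Ideal A) →ₗ[A] A, LinearMap.range φ : Ideal A) = ⊤ :=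
  top_le_iff.mp (le_traceIdeal (⊤ : Ideal A))

/-- **`τ` only depends on the isomorphism class of `I` as an `A`-module**: `I ≅ J ⇒ τ(I) = τ(J)`. [folklore] -/
theorem traceIdeal_eq_of_linearEquiv {A : Type u} [CommRing A] {I J : Ideal A} (e : I ≃ₗ[A] J) :
    (⨆ φ : I →ₗ[A] A, LinearMap.range φ : Ideal A) = ⨆ ψ : J →ₗ[A] A, LinearMap.range ψ := by
  refine le_antisymm (iSup_le fun φ => ?_) (iSup_le fun ψ => ?_)
  · refine le_trans (le_of_eq ?_) (le_iSup (fun ψ : J →ₗ[A] A => LinearMap.range ψ) (φ ∘ₗ (e.symm : J →ₗ[A] I)))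
    rw [LinearMap.range_comp_of_range_eq_top]
    exact LinearEquiv.range e.symm
  · refine le_trans (le_of_eq ?_) (le_iSup (fun φ : I →ₗ[A] A => LinearMap.range φ) (ψ ∘ₗ (e : I →ₗ[A] J)))
    rw [LinearMap.range_comp_of_range_eq_top]
    exact LinearEquiv.range e

/-! ## §2 Principal ideals -/

/-- **`(a) ≅ A` for a non-zero-divisor `a`**, as an existence statement: a linear isomorphism `A ≃ₗ (a)` sending `1` to `a`. [folklore] -/
theorem exists_linearEquiv_span_singleton {A : Type u} [CommRing A] (a : A) (ha : a ∈ nonZeroDivisors A) :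
    ∃ e : A ≃ₗ[A] ↥(Ideal.span ({a} : Set A)), (e 1 : A) = a := by
  have hinj : Function.Injective (LinearMap.toSpanSingleton A A a) := by
    rw [injective_iff_map_eq_zero]
    intro r hr
    rw [LinearMap.toSpanSingleton_apply, smul_eq_mul, mul_comm] at hr
    exact (mem_nonZeroDivisors_iff.mp ha).1 r hr
  have hrange : LinearMap.range (LinearMap.toSpanSingleton A A a) = (Ideal.span ({a} : Set A) : Submodule A A) :=
    LinearMap.range_toSpanSingleton a
  refine ⟨(LinearEquiv.ofInjective _ hinj).trans (LinearEquiv.ofEq _ _ hrange), ?_⟩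
  simp [LinearEquiv.ofInjective_apply, LinearMap.toSpanSingleton_apply]

/-- ★ **`τ((a)) = A` for a non-zero-divisor `a`.** [folklore] -/
theorem traceIdeal_eq_top_of_mem_nonZeroDivisors {A : Type u} [CommRing A] (a : A) (ha : a ∈ nonZeroDivisors A) :
    (⨆ φ : ↥(Ideal.span ({a} : Set A)) →ₗ[A] A, LinearMap.range φ : Ideal A) = ⊤ := by
  obtain ⟨e, -⟩ := exists_linearEquiv_span_singleton a ha
  have h := traceIdeal_eq_of_linearEquiv (I := ⊤) (J := Ideal.span ({a} : Set A))
    ((Submodule.topEquiv : (⊤ : Ideal A) ≃ₗ[A] A).trans e)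
  rw [← h]
  exact traceIdeal_top

/-- **A nonzero principal ideal is a nonzero divisorial (v-) ideal** in the sense of `…DivisorialIdealsCharacteristic` (take the test pair `(a, 1)`).
[folklore; cite: Matsumura1987, §11] -/
theorem divisorial_span_singleton {A : Type u} [CommRing A] (a : A) (ha0 : a ≠ 0) :
    Ideal.span ({a} : Set A) ≠ ⊥ ∧
      ∀ x : A, (∀ c b : A, (∀ y ∈ Ideal.span ({a} : Set A), b * y ∈ Ideal.span ({c} : Set A)) → b * x ∈ Ideal.span ({c} : Set A)) →
        x ∈ Ideal.span ({a} : Set A) := by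
  refine ⟨fun h => ha0 (by simpa [Ideal.span_singleton_eq_bot] using h), fun x hx => ?_⟩
  have h := hx a 1 (fun y hy => by rwa [one_mul])
  rwa [one_mul] at h

/-- Hence `⊤ ∈ 𝒯`: the set of trace ideals of the nonzero divisorial ideals contains `⊤` as soon as `A` has a non-zero-divisor `a ≠ 0` (e.g. `A` a
domain, `A ≠ 0`): principal classes contribute the factor `⊤` to `𝔞_tot = ∏_{T ∈ 𝒯} T`. [folklore] -/
theorem top_mem {A : Type u} [CommRing A] (a : A) (ha0 : a ≠ 0) (ha : a ∈ nonZeroDivisors A) :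
    (⊤ : Ideal A) ∈ {T : Ideal A | ∃ I : Ideal A,
      (I ≠ ⊥ ∧ ∀ x : A, (∀ c b : A, (∀ y ∈ I, b * y ∈ Ideal.span ({c} : Set A)) → b * x ∈ Ideal.span ({c} : Set A)) → x ∈ I) ∧
      T = ⨆ φ : I →ₗ[A] A, LinearMap.range φ} :=
  ⟨Ideal.span {a}, divisorial_span_singleton a ha0, (traceIdeal_eq_top_of_mem_nonZeroDivisors a ha).symm⟩

end Summit.ResolutionOfSingularities.ResolutionOfSingularities.Theorems.FRationalResolution.TraceIdealBasics
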